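import Summits.KontsevichZagierPeriods.KontsevichZagierPeriods.Theses.MultivaluedCoV
import Summits.KontsevichZagierPeriods.KontsevichZagierPeriods.Theorems.MultivaluedCoVEllipticAreaIdentityHalfPlane
import Summits.KontsevichZagierPeriods.KontsevichZagierPeriods.Theorems.MultivaluedCoVEllipticAreaIdentityParam
import Summits.KontsevichZagierPeriods.KontsevichZagierPeriods.Theorems.MultivaluedCoVEllipticAreaIdentityCubic
import Summits.KontsevichZagierPeriods.KontsevichZagierPeriods.Theorems.MultivaluedCoVEllipticAreaIdentityJacobian
import Summits.KontsevichZagierPeriods.KontsevichZagierPeriods.Theorems.MultivaluedCoVEllipticAreaIdentityAlgebra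
import Literature.NumberTheory.EllipticCurves.UniformizationProofs
import Literature.NumberTheory.EllipticCurves.UniformizationUniqueProofs
import HarnessLib

/-!
# The group law of `y² = 4x³ − g₂x − g₃` is ONE change of variables (crux `EllipticAreaCoV`)

Draft closing file for the crux item `EllipticAreaCoV` (stmt-KontsevichZagierPeriods-2875) of route
`MultivaluedCoV` (`Summits/KontsevichZagierPeriods/KontsevichZagierPeriods/Theses/MultivaluedCoV.lean`):
for `g₂, g₃ ∈ ℚ` with `g₂³ − 27g₃² > 0`, `P = 4x³ − g₂x − g₃` with real roots `e₃ < e₂ < e₁`,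
`[R, 1/√(−P(s)P(t))] − [H, 1/|P(u+iv)|] ∈ KZ.changeOfVariablesRel`, `R = (e₁,∞) × (−∞,e₃)`,
`H` the open upper half-plane: a real rectangular lattice with invariants `g₂, g₃`
(`PeriodPair.uniformization_holds`, `uniformization_unique_holds`, `isReal_of_g₂_g₃_real`), and the
addition-law map `Φ(s,t) = (re, im) ℘(a s − i c t)` (`of_sub_of_mem_changeOfVariablesRel_of_eqOn`,
the variant of `…EllipticAreaIdentity.of_sub_of_mem_changeOfVariablesRel` with the target
integrand prescribed on `H` only).

## References
* M. Kontsevich, D. Zagier, *Periods* (2001), §1.2, rule 2.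
* D. F. Lawden, *Elliptic Functions and Applications*, Springer 1989, §§6.8, 6.11–6.12.
* J. H. Silverman, *The Arithmetic of Elliptic Curves*, 2nd ed., VI.5.1, III.5.
-/

noncomputable section

open scoped ComplexConjugate Topology PeriodPair
open Complex Set Filter MeasureTheory MvPolynomial ContinuousLinearMap
open Literature.NumberTheory.Transcendental Literature.ModelTheory.ExponentialFields

namespace Summit.KontsevichZagierPeriods.MultivaluedCoV.EllipticArea

/-! ### The group law as one change of variables: `[R, 1/√(−P(s)P(t))] − [H, 1/|P|]` -/

variable {L : PeriodPair}

/-- **The addition law of `y² = P(x)` is one instance of rule 2.** Let `Λ` be a real rectangular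
lattice with rational invariants `g₂, g₃`, `e₁ = ℘(Ω₀/2)`, `e₃ = ℘(iΩ₀'/2)`, and let `a`, `c` invert
`℘` on the real and imaginary half-period segments (`℘(a s) = s`, `℘(i c t) = t`, with the
derivatives `a' = −1/√P`, `c' = 1/√(−P)`). For `r' = [(e₁,∞) × (−∞,e₃), 1/√(−P(s)P(t))]` and
`rH = [H, 1/|P(u+iv)|]`, `H` the open upper half-plane (integrand prescribed on `H` only),
`[r'] − [rH] ∈ KZ.changeOfVariablesRel` along `Φ(s,t) = (re, im) ℘(a s − i c t)`:
`Φ` is the algebraic addition-law map (hence `ℚ`-semialgebraic), injective on `R` with image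
exactly `{v > 0}`, differentiable, and `1/√(−P(s)P(t)) = |det Φ'|/|P(Φ)|` (Lawden §6.8, §6.11;
Silverman AEC III.5). -/
theorem of_sub_of_mem_changeOfVariablesRel_of_eqOn (h : L.IsReal)
    (hrect : ((L.minRealPeriod : ℂ) + I * (L.mulLeft I I_ne_zero).minRealPeriod) / 2 ∉ L.lattice)
    {g₂ g₃ : ℚ} (hA : L.g₂.re = g₂) (hB : L.g₃.re = g₃)
    {e₁ e₃ : ℝ} (he₁ : e₁ = L.weierstrassPRe (L.minRealPeriod / 2))
    (he₃ : e₃ = -(L.mulLeft I I_ne_zero).weierstrassPRe ((L.mulLeft I I_ne_zero).minRealPeriod / 2))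
    {a c : ℝ → ℝ}
    (ha : ∀ x, e₁ < x → a x ∈ Ioo 0 (L.minRealPeriod / 2) ∧ ℘[L] (a x) = x ∧
      ℘'[L] (a x) = -(Real.sqrt (4 * x ^ 3 - L.g₂.re * x - L.g₃.re) : ℝ))
    (ha2 : ∀ t ∈ Ioo 0 (L.minRealPeriod / 2), a ((℘[L] t).re) = t)
    (had : ∀ x, e₁ < x → HasDerivAt a (-(Real.sqrt (4 * x ^ 3 - L.g₂.re * x - L.g₃.re))⁻¹) x)
    (hc : ∀ t, t < e₃ → c t ∈ Ioo 0 ((L.mulLeft I I_ne_zero).minRealPeriod / 2) ∧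
      ℘[L] (I * c t) = t ∧
      ℘'[L] (I * c t) = -I * (Real.sqrt (-(4 * t ^ 3 - L.g₂.re * t - L.g₃.re)) : ℝ))
    (hc2 : ∀ u ∈ Ioo 0 ((L.mulLeft I I_ne_zero).minRealPeriod / 2), c ((℘[L] (I * u)).re) = u)
    (hcd : ∀ t, t < e₃ → HasDerivAt c (Real.sqrt (-(4 * t ^ 3 - L.g₂.re * t - L.g₃.re)))⁻¹ t)
    (r' rH : KZ.IntegralRep 2)
    (hr' : r'.domain = {z | e₁ < z 0 ∧ z 1 < e₃})
    (hr'i : EqOn r'.integrand (fun z => 1 / Real.sqrt (-((4 * z 0 ^ 3 - L.g₂.re * z 0 - L.g₃.re) *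
      (4 * z 1 ^ 3 - L.g₂.re * z 1 - L.g₃.re)))) r'.domain)
    (hHd : rH.domain = {w | 0 < w 1})
    (hHi : EqOn rH.integrand (fun w => 1 / ‖4 * ((w 0 : ℂ) + (w 1 : ℂ) * I) ^ 3 -
      L.g₂ * ((w 0 : ℂ) + (w 1 : ℂ) * I) - L.g₃‖) rH.domain) :
    KZ.of r' - KZ.of rH ∈ KZ.changeOfVariablesRel := by
  refine ⟨2, r', rH,
    fun z => (ContinuousLinearMap.pi ![reCLM, imCLM] : ℂ →L[ℝ] (Fin 2 → ℝ))
      (℘[L] (((a (z 0) : ℝ) : ℂ) - I * ((c (z 1) : ℝ) : ℂ))),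
    fun z => (ContinuousLinearMap.pi ![reCLM, imCLM] : ℂ →L[ℝ] (Fin 2 → ℝ)).comp
      (℘'[L] (((a (z 0) : ℝ) : ℂ) - I * ((c (z 1) : ℝ) : ℂ)) •
        (ofRealCLM.comp ((-(Real.sqrt (4 * z 0 ^ 3 - L.g₂.re * z 0 - L.g₃.re))⁻¹) • proj 0) -
          I • ofRealCLM.comp
            ((Real.sqrt (-(4 * z 1 ^ 3 - L.g₂.re * z 1 - L.g₃.re)))⁻¹ • proj 1))),
    ?_, ?_, ?_, ?_, ?_, rfl⟩
  · -- `Φ` is the algebraic addition-law map on `R`, hence `ℚ`-semialgebraic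
    have hne : ∀ z ∈ r'.domain, z 0 ≠ z 1 := by
      intro z hz heq
      rw [hr'] at hz
      have h1 := h.cubic_pos_of_lt (x := z 0) (by rw [← he₁]; exact hz.1)
      have h2 := h.cubic_neg_of_lt (x := z 1) (by rw [← he₃]; exact hz.2)
      rw [heq] at h1
      linarith
    refine (isSemialgebraicMapOn_additionMap g₂ g₃ r'.isSemialgebraic_domain hne).congr
      fun z hz => ?_
    rw [hr'] at hz
    have hP := weierstrassP_zeta_eq h he₁ he₃ ha hc hz.1 hz.2
    simp only [reIm_apply, hP, add_re, ofReal_re, mul_re, I_re, mul_zero, ofReal_im, I_im,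
      mul_one, sub_self, add_zero, add_im, mul_im, zero_add, hA, hB]
  · -- derivative within `R` (chain rule, `…Jacobian`)
    intro z hz
    rw [hr'] at hz
    obtain ⟨hq0, hq1, -, -⟩ := zeta_mem_quarter ha hc hz.1 hz.2
    have hΛ := notMem_lattice_of_mem_quarter h hrect hq0 hq1
    exact (hasFDerivAt_phi (had (z 0) hz.1) (hcd (z 1) hz.2) hΛ).hasFDerivWithinAt
  · -- injective on `R`
    rw [hr']
    intro z hz z' hz' heq
    apply injOn_weierstrassP_zeta h hrect ha hc hz hz'
    have h0 := congr_fun heq 0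
    have h1 := congr_fun heq 1
    simp only [reIm_apply, Matrix.cons_val_zero, Matrix.cons_val_one] at h0 h1
    exact Complex.ext h0 h1
  · -- the image is exactly the open upper half-plane
    rw [hHd, hr']
    ext w
    constructor
    · intro hw
      obtain ⟨z, hz, hPz⟩ := exists_weierstrassP_zeta_eq h hrect he₁ he₃ ha ha2 hc hc2
        (w := (w 0 : ℂ) + (w 1 : ℂ) * I) (by simpa using hw)
      refine ⟨z, hz, ?_⟩
      simp only [hPz, reIm_apply]
      ext i
      fin_cases i <;> simp
    · rintro ⟨z, hz, rfl⟩
      simp only [mem_setOf_eq, reIm_apply, Matrix.cons_val_one]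
      exact weierstrassP_zeta_im_pos h he₁ he₃ ha hc hz.1 hz.2
  · -- the Jacobian identity (`…Jacobian`)
    intro z hz
    have hz' := hz
    rw [hr'] at hz'
    obtain ⟨hq0, hq1, -, -⟩ := zeta_mem_quarter ha hc hz'.1 hz'.2
    have hΛ := notMem_lattice_of_mem_quarter h hrect hq0 hq1
    have hder := derivWeierstrassP_ne_zero_of_mem_quarter h hrect hq0 hq1
    have hfs := h.cubic_pos_of_lt (x := z 0) (by rw [← he₁]; exact hz'.1)
    have hft := h.cubic_neg_of_lt (x := z 1) (by rw [← he₃]; exact hz'.2)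
    have hmem : (ContinuousLinearMap.pi ![reCLM, imCLM] : ℂ →L[ℝ] (Fin 2 → ℝ))
        (℘[L] (((a (z 0) : ℝ) : ℂ) - I * ((c (z 1) : ℝ) : ℂ))) ∈ rH.domain := by
      rw [hHd]
      simp only [mem_setOf_eq, reIm_apply, Matrix.cons_val_one]
      exact weierstrassP_zeta_im_pos h he₁ he₃ ha hc hz'.1 hz'.2
    rw [hr'i hz, hHi hmem]
    simp only [reIm_apply, Matrix.cons_val_zero, Matrix.cons_val_one, Complex.re_add_im]
    exact jacobian_identity hΛ hder hfs hft

/-! ### The closing theorem -/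

/-- **The group law is one change of variables** (crux `EllipticAreaCoV` of route `MultivaluedCoV`):
for `g₂, g₃ ∈ ℚ` with `g₂³ − 27g₃² > 0`, `[R, 1/√(−P(s)P(t))] − [H, 1/|P(u+iv)|]` is a single
instance of Kontsevich–Zagier's rule 2 (the addition law `℘(α − iβ)` through the uniformisation by a
real rectangular lattice; image EXACTLY the open upper half-plane). -/
theorem ellipticAreaCoV_proof :
    Summit.KontsevichZagierPeriods.KontsevichZagierPeriods.Theses.MultivaluedCoV.EllipticAreaCoV := by
  intro g₂ g₃ hdisc r r' hr hri hr' hr'i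
  -- a real rectangular lattice with invariants `g₂, g₃`
  have hD : (g₂ : ℂ) ^ 3 - 27 * (g₃ : ℂ) ^ 2 ≠ 0 := by
    have : ((g₂ ^ 3 - 27 * g₃ ^ 2 : ℚ) : ℂ) ≠ 0 := by exact_mod_cast hdisc.ne'
    push_cast at this
    exact this
  obtain ⟨L, hL2, hL3⟩ := PeriodPair.uniformization_holds _ _ hD
  have h : L.IsReal := PeriodPair.isReal_of_g₂_g₃_real PeriodPair.uniformization_unique_holds
    (by rw [hL2]; exact Complex.ratCast_im g₂) (by rw [hL3]; exact Complex.ratCast_im g₃)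
  have hA : L.g₂.re = g₂ := by rw [hL2]; exact Complex.ratCast_re g₂
  have hB : L.g₃.re = g₃ := by rw [hL3]; exact Complex.ratCast_re g₃
  have hdisc' : 0 < L.g₂.re ^ 3 - 27 * L.g₃.re ^ 2 := by
    rw [hA, hB]
    exact_mod_cast hdisc
  have hrect := h.half_sum_notMem_of_discr_pos hdisc'
  obtain ⟨a, ha, ha2, had⟩ := exists_inverse_weierstrassP_real h
  obtain ⟨c, hc, hc2, hcd⟩ := exists_inverse_weierstrassP_imag h
  -- the change of variables, in lattice coordinates
  rw [← hL2, ← hL3] at hr'i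
  rw [← hA, ← hB, setOf_domain_eq h hdisc'] at hr
  rw [← hA, ← hB] at hri
  exact of_sub_of_mem_changeOfVariablesRel_of_eqOn h hrect hA hB rfl rfl ha ha2 had hc hc2 hcd
    r r' hr hri hr' hr'i

end Summit.KontsevichZagierPeriods.MultivaluedCoV.EllipticArea

end
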